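import Mathlib
import Literature.AlgebraicGeometry.Resolution.CobordantBlowupGlobal
import Summits.ResolutionOfSingularities.ResolutionOfSingularities.Theorems.WeightedInvariantDatumToEmbeddedAtlasDefs
import Summits.ResolutionOfSingularities.ResolutionOfSingularities.Theorems.WeightedInvariantDatumToEmbeddedStrictTransformCharts
import Summits.ResolutionOfSingularities.ResolutionOfSingularities.Theorems.WeightedInvariantDatumToEmbeddedExceptional
import HarnessLib

/-!
# The charts `D(v)` of the global cobordant blow-up inside `B₊`: sections, `t⁻¹`, strict transform

Topic: `Summits/ResolutionOfSingularities/ResolutionOfSingularities/Theorems`. Chart computations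
for stub `stub_qs_atlas_ambient` (line `Sketch`, crux `Theses.WeightedInvariant.DatumToEmbedded`,
`stmt-ResolutionOfSingularities-0572`). Setting (J. Włodarczyk, arXiv:2203.03090, Def. 2.3.5,
§2.3.3, 3.3.12, Def. 5.1.1; tree `Literature/…/CobordantBlowupGlobal.lean`): `B = Spec_Y ⊕ₙ 𝒥ₙ tⁿ`
is glued from the charts `Spec ⊕ₙ 𝒥ₙ(U) tⁿ` (`R'.openCover`), `B₊ = R'.plus ⊆ B`,
`σ₊ = R'.πPlus`, `t⁻¹|_{W'} = tInvOn R' W'` (`…AtlasDefs.lean`), strict transform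
`R'.strictTransformPlus K`. For `v` in the sections ring `⊕ₙ 𝒥ₙ(U) tⁿ` with `D(v)` mapping into `B₊`
and ANY localisation `L` at `v` (§2.3.3: the charts `B_{x'ᵢ} = D(xᵢ t^{wᵢ})` of `B₊`):

* `appLE_comp_appIso_hom'`, `appIso_hom_appLE_X'` — `π♯` and `τ♯x` through `Γ(B, φ(Spec R)) ≅ R`
  for a chart from an arbitrary affine scheme (as in `…DatumToEmbedded.StrictTransform`);
* `strictTransformPlus_ideal_eq` — **on an affine open `W'` of `B₊` over `U` the strict transform
  has sections `⋃ₙ (K(U)·Γ(B₊, W') : (t⁻¹|_{W'})ⁿ)`** (`iSup_colon_ideal_eq` along `B₊ ⊆ B`);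
* the chart `ψ : Spec L ⟶ B₊` (`exists_fac`, `fac_πPlus`, `fac_toA1`) and, through
  `Γ(B₊, ψ(Spec L)) ≅ L`: `σ₊♯ s ↦ s/1`, `t⁻¹ ↦ t⁻¹/1`, the strict transform
  `↦ ⋃ₙ (K(U) L : (t⁻¹)ⁿ)` (`chartIso_appLE`, `chartIso_tInvOn`, `strictTransformPlus_ideal_chart`);
* `not_mem_of_isUnit`, `exists_chart` — **`D(β t^D)` is the locus where `σ₊♯β = (t⁻¹)^D · unit`**
  (restrict to a chart `D(g)` inside the neighbourhood and cancel the non-zero-divisor `(t⁻¹)^D`;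
  the cancellation is the hypothesis `hcancel`, discharged by the ring-level companion file).

All proofs are glue on Mathlib and the tree; no definitions, no named facts.
-/

open scoped LaurentPolynomial
open LaurentPolynomial CategoryTheory CategoryTheory.Limits AlgebraicGeometry TopologicalSpace
open Literature.AlgebraicGeometry.Resolution
open Summit.ResolutionOfSingularities.ResolutionOfSingularities.Theorems

set_option linter.dupNamespace false -- mandated namespace `…Theorems.DatumToEmbedded.<Topic>`
-- `Γ(Y, U)` versus `Y.presheaf.obj (op U)` inside `rw` motives and instance problems on the glued
-- scheme `R'.cobordantBlowup` (as in `…DatumToEmbedded.InvDrop`, `…Exceptional`):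
set_option backward.isDefEq.respectTransparency false

namespace Summit.ResolutionOfSingularities.ResolutionOfSingularities.Theorems.DatumToEmbedded.AtlasAmbient

/-! ## Charts from an arbitrary affine scheme -/

section Generic

variable {Y B : Scheme.{0}} (π : B ⟶ Y) (U : Y.affineOpens) {Rg : CommRingCat.{0}}
  (φ : Spec Rg ⟶ B) [IsOpenImmersion φ] (alg : Γ(Y, U) ⟶ Rg)
  (hφπ : φ ≫ π = Spec.map alg ≫ U.2.fromSpec)

include hφπ in
/-- **The structure map of a chart**: through `Γ(B, φ(Spec R)) ≅ R`, the pull-back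
`π♯ : Γ(Y, U) → Γ(B, chart)` is the given ring map `Γ(Y, U) → R`. [folklore] -/
theorem appLE_comp_appIso_hom' (hle : φ ''ᵁ ⊤ ≤ π ⁻¹ᵁ (U : Y.Opens)) :
    π.appLE U (φ ''ᵁ ⊤) hle ≫ (φ.appIso ⊤).hom ≫ (Scheme.ΓSpecIso Rg).hom = alg := by
  rw [Scheme.Hom.appIso_hom', Scheme.Hom.appLE_comp_appLE_assoc, appLE_congr_hom hφπ,
    ← Scheme.Hom.appLE_comp_appLE_assoc _ _ _ ⊤ _ (by rw [U.2.fromSpec_preimage_self]) le_top,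
    fromSpec_appLE_top, StrictTransform.appLE_top_comp_ΓSpecIso_hom]
  exact Iso.inv_hom_id_assoc _ _

variable (τ : B ⟶ Spec (CommRingCat.of (Polynomial ReesFiltration.ZZ.{0})))
  (ρ : CommRingCat.of (Polynomial ReesFiltration.ZZ.{0}) ⟶ Rg) (hφτ : φ ≫ τ = Spec.map ρ)

include hφτ in
/-- Through the same isomorphism, the section `τ♯x` over a chart with `φ ≫ τ = Spec ρ` is `ρ x`.
[folklore] -/
theorem appIso_hom_appLE_X' :
    (Scheme.ΓSpecIso Rg).hom ((φ.appIso ⊤).hom (τ.appLE ⊤ (φ ''ᵁ ⊤) le_top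
      ((Scheme.ΓSpecIso (CommRingCat.of (Polynomial ReesFiltration.ZZ.{0}))).inv Polynomial.X))) =
      ρ Polynomial.X := by
  rw [Scheme.Hom.appIso_hom', ← CommRingCat.comp_apply, ← CommRingCat.comp_apply,
    Scheme.Hom.appLE_comp_appLE_assoc, appLE_congr_hom hφτ, StrictTransform.appLE_top_comp_ΓSpecIso_hom,
    CommRingCat.comp_apply, Iso.inv_hom_id_apply]

omit [IsOpenImmersion φ] in
/-- Restricting a pulled-back section is pulling back to the smaller open. [folklore] -/
theorem map_appLE {X : Scheme.{0}} (f : X ⟶ Y) (O W : X.Opens) (hle : W ≤ O)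
    (hO : O ≤ f ⁻¹ᵁ (U : Y.Opens)) (s : Γ(Y, U)) :
    (X.presheaf.map (homOfLE hle).op) (f.appLE U O hO s) = f.appLE U W (hle.trans hO) s := by
  rw [← Scheme.Hom.appLE_map f hO (homOfLE hle).op]
  rfl

end Generic

/-! ## The strict transform on affine opens of `B₊` -/

section Plus

variable {Y : Scheme.{0}} (R' : ReesFiltration Y)

/-- `t⁻¹|_{W'}` is the restriction of `t⁻¹|_{ι(W')}` through `Γ(B, ι(W')) ≅ Γ(B₊, W')`. [folklore] -/
theorem appIso_hom_appLE_X_eq_tInvOn (W' : (R'.plus : Scheme.{0}).Opens) :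
    (R'.plus.ι.appIso W').hom (R'.toA1.appLE ⊤ (R'.plus.ι ''ᵁ W') le_top
      ((Scheme.ΓSpecIso (CommRingCat.of (Polynomial ReesFiltration.ZZ.{0}))).inv Polynomial.X)) =
      tInvOn R' W' := by
  rw [tInvOn, Scheme.Hom.appIso_hom', ← CommRingCat.comp_apply, Scheme.Hom.appLE_comp_appLE]

/-- **Sections of the strict transform over an affine open `W'` of `B₊` lying over `U`** (`B`
locally Noetherian): the saturation `⋃ₙ (K(U)·Γ(B₊, W') : (t⁻¹|_{W'})ⁿ)`.
[cite: Wlodarczyk2022, 3.3.12] -/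
theorem strictTransformPlus_ideal_eq [IsLocallyNoetherian R'.cobordantBlowup] (K : Y.IdealSheafData)
    (U : Y.affineOpens) (W' : (R'.plus : Scheme.{0}).affineOpens)
    (hW' : (W' : (R'.plus : Scheme.{0}).Opens) ≤ R'.πPlus ⁻¹ᵁ (U : Y.Opens)) :
    (R'.strictTransformPlus K).ideal W' =
      ⨆ n : ℕ, ((K.ideal U).map (R'.πPlus.appLE U W' hW').hom).colon
        ((Ideal.span {tInvOn R' W'} ^ n : Ideal Γ((R'.plus : Scheme.{0}), W')) :
          Set Γ((R'.plus : Scheme.{0}), W')) := by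
  have hle : R'.plus.ι ''ᵁ (W' : (R'.plus : Scheme.{0}).Opens) ≤ R'.π ⁻¹ᵁ (U : Y.Opens) := by
    rintro _ ⟨x, hx, rfl⟩
    have h := hW' hx
    rwa [ReesFiltration.πPlus, Scheme.Hom.comp_preimage] at h
  rw [ReesFiltration.strictTransformPlus, Scheme.IdealSheafData.ideal_comap_of_isOpenImmersion,
    ReesFiltration.strictTransform, ReesFiltration.exc,
    StrictTransform.iSup_colon_ideal_eq R'.π R'.toA1 K U ⟨R'.plus.ι ''ᵁ W', _⟩ hle]
  symm
  refine StrictTransform.comap_iSup_colon_span_singleton_pow _ _ _ _ _ ?_ ?_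
  · rw [← appIso_hom_appLE_X_eq_tInvOn, ← CommRingCat.comp_apply, Iso.hom_inv_id, CommRingCat.id_apply]
  · rw [CentreHomogeneous.ideal_comap_iso_inv, Ideal.map_map, ← CommRingCat.hom_comp,
      Scheme.Hom.appIso_hom', Scheme.Hom.appLE_comp_appLE]
    rfl

end Plus

/-! ## The charts `D(v) = Spec (⊕ 𝒥ₙ(U) tⁿ)[1/v] ⟶ B₊` -/

section Chart

variable {Y : Scheme.{0}} (R' : ReesFiltration Y) (U : Y.affineOpens)
  (L : Type) [CommRing L] [Algebra (R'.sectionsRing U) L]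

/-- **The chart `ψ : Spec (⊕ 𝒥ₙ(U) tⁿ)[1/v] ⟶ B₊`** exists as soon as the localisation chart
followed by the chart of `B` over `U` lands in `B₊`. [folklore] -/
theorem exists_fac
    (hO : ∀ x : Spec (CommRingCat.of L), R'.openCover.f ⟨U.1, U.2⟩
      (Spec.map (CommRingCat.ofHom (algebraMap (R'.sectionsRing U) L)) x) ∈ R'.plus) :
    ∃ ψ : Spec (CommRingCat.of L) ⟶ (R'.plus : Scheme.{0}), ψ ≫ R'.plus.ι =
      Spec.map (CommRingCat.ofHom (algebraMap (R'.sectionsRing U) L)) ≫ R'.openCover.f ⟨U.1, U.2⟩ := by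
  refine ⟨IsOpenImmersion.lift R'.plus.ι _ ?_, IsOpenImmersion.lift_fac _ _ _⟩
  rintro _ ⟨x, rfl⟩
  rw [Scheme.Opens.range_ι]
  exact hO x

variable (ψ : Spec (CommRingCat.of L) ⟶ (R'.plus : Scheme.{0}))
  (hψ : ψ ≫ R'.plus.ι =
    Spec.map (CommRingCat.ofHom (algebraMap (R'.sectionsRing U) L)) ≫ R'.openCover.f ⟨U.1, U.2⟩)

include hψ

/-- `ψ` is an open immersion (when `L` is a localisation at one element). [folklore] -/
theorem isOpenImmersion_of_fac (v : R'.sectionsRing U) [IsLocalization.Away v L] :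
    IsOpenImmersion ψ := by
  haveI : IsOpenImmersion (Spec.map (CommRingCat.ofHom
      (algebraMap (R'.sectionsRing U) L))) :=
    IsOpenImmersion.of_isLocalization v
  haveI : IsOpenImmersion (ψ ≫ R'.plus.ι) := by rw [hψ]; infer_instance
  exact IsOpenImmersion.of_comp ψ R'.plus.ι

/-- **`ψ` lies over `Spec L → Spec Γ(Y, U) ≅ U ⊆ Y`** (`R'.ι_π`). [folklore] -/
theorem fac_πPlus : ψ ≫ R'.πPlus = Spec.map (CommRingCat.ofHom
    ((algebraMap (R'.sectionsRing U) L).comp (algebraMap Γ(Y, U) (R'.sectionsRing U)))) ≫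
      U.2.fromSpec := by
  rw [ReesFiltration.πPlus, ← Category.assoc, hψ, Category.assoc, R'.ι_π, ← Spec.map_comp_assoc]
  rfl

/-- **`ψ` is compatible with `t⁻¹`** (`R'.ι_toA1`). [folklore] -/
theorem fac_toA1 : ψ ≫ (R'.plus.ι ≫ R'.toA1) = Spec.map (CommRingCat.ofHom
    ((algebraMap (R'.sectionsRing U) L).comp (R'.polyToSections U))) := by
  rw [← Category.assoc, hψ, Category.assoc, R'.ι_toA1, ← Spec.map_comp]
  rfl

/-- The chart lies over `U`. [folklore] -/
theorem image_top_le [IsOpenImmersion ψ] : ψ ''ᵁ ⊤ ≤ R'.πPlus ⁻¹ᵁ (U : Y.Opens) := by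
  rintro _ ⟨x, -, rfl⟩
  change (ψ ≫ R'.πPlus) x ∈ (U : Y.Opens)
  rw [fac_πPlus R' U L ψ hψ, ← SetLike.mem_coe, ← U.2.range_fromSpec]
  exact ⟨_, rfl⟩

/-- **`σ₊♯ s ↦ s / 1`** through the coordinate ring `Γ(B₊, ψ(Spec L)) ≅ L`. [folklore] -/
theorem chartIso_appLE [IsOpenImmersion ψ] (s : Γ(Y, U)) :
    (ψ.appIso ⊤ ≪≫ Scheme.ΓSpecIso (CommRingCat.of L)).commRingCatIsoToRingEquiv
      (R'.πPlus.appLE U (ψ ''ᵁ ⊤) (image_top_le R' U L ψ hψ) s) =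
      algebraMap (R'.sectionsRing U) L (algebraMap Γ(Y, U) (R'.sectionsRing U) s) := by
  change (R'.πPlus.appLE U (ψ ''ᵁ ⊤) (image_top_le R' U L ψ hψ) ≫ (ψ.appIso ⊤).hom ≫
    (Scheme.ΓSpecIso (CommRingCat.of L)).hom) s = _
  rw [appLE_comp_appIso_hom' R'.πPlus U ψ _ (fac_πPlus R' U L ψ hψ) (image_top_le R' U L ψ hψ)]
  rfl

/-- **`t⁻¹ ↦ t⁻¹ / 1`** through `Γ(B₊, ψ(Spec L)) ≅ L`. [folklore] -/
theorem chartIso_tInvOn [IsOpenImmersion ψ] :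
    (ψ.appIso ⊤ ≪≫ Scheme.ΓSpecIso (CommRingCat.of L)).commRingCatIsoToRingEquiv
      (tInvOn R' (ψ ''ᵁ ⊤)) = algebraMap (R'.sectionsRing U) L
      ⟨T (-1), (R'.filtration U).T_neg_one_mem_extendedRees⟩ := by
  change (Scheme.ΓSpecIso (CommRingCat.of L)).hom ((ψ.appIso ⊤).hom (tInvOn R' (ψ ''ᵁ ⊤))) = _
  rw [tInvOn, appIso_hom_appLE_X' ψ (R'.plus.ι ≫ R'.toA1) _ (fac_toA1 R' U L ψ hψ)]
  exact congrArg (algebraMap (R'.sectionsRing U) L) (R'.polyToSections_X U)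

/-- **The strict transform on the chart is the `t⁻¹`-saturation `⋃ₙ (K(U) L : (t⁻¹)ⁿ)`**,
through `Γ(B₊, ψ(Spec L)) ≅ L`. [cite: Wlodarczyk2022, 3.3.12] -/
theorem strictTransformPlus_ideal_chart [IsOpenImmersion ψ] [IsLocallyNoetherian R'.cobordantBlowup]
    (K : Y.IdealSheafData) :
    (R'.strictTransformPlus K).ideal ⟨ψ ''ᵁ ⊤, (isAffineOpen_top _).image_of_isOpenImmersion ψ⟩ =
      (⨆ n : ℕ, ((K.ideal U).map ((algebraMap (R'.sectionsRing U) L).comp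
        (algebraMap Γ(Y, U) (R'.sectionsRing U)))).colon
        ((Ideal.span {algebraMap (R'.sectionsRing U) L
          ⟨T (-1), (R'.filtration U).T_neg_one_mem_extendedRees⟩} ^ n : Ideal L) : Set L)).comap
        (ψ.appIso ⊤ ≪≫ Scheme.ΓSpecIso (CommRingCat.of L)).commRingCatIsoToRingEquiv.toRingHom := by
  rw [strictTransformPlus_ideal_eq R' K U ⟨ψ ''ᵁ ⊤, _⟩ (image_top_le R' U L ψ hψ)]
  refine StrictTransform.comap_iSup_colon_span_singleton_pow _ _ _ _ _
    (chartIso_tInvOn R' U L ψ hψ) ?_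
  have h1 : ((K.ideal U).map (R'.πPlus.appLE U (ψ ''ᵁ ⊤) (image_top_le R' U L ψ hψ)).hom).map
      (ψ.appIso ⊤ ≪≫ Scheme.ΓSpecIso (CommRingCat.of L)).commRingCatIsoToRingEquiv.toRingHom = (K.ideal U).map ((algebraMap (R'.sectionsRing U) L).comp
        (algebraMap Γ(Y, U) (R'.sectionsRing U))) := by
    rw [Ideal.map_map]
    congr 1
    exact RingHom.ext fun s => chartIso_appLE R' U L ψ hψ s
  rw [← h1]
  exact Ideal.comap_map_of_bijective _ (ψ.appIso ⊤ ≪≫ Scheme.ΓSpecIso (CommRingCat.of L)).commRingCatIsoToRingEquiv.bijective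

end Chart

/-! ## The chart `D(v₀)` is the locus where `σ₊♯β = (t⁻¹)^D · unit` -/

section MemIff

variable {Y : Scheme.{0}} (R' : ReesFiltration Y) (U : Y.affineOpens)
  (L : Type) [CommRing L] [Algebra (R'.sectionsRing U) L] (v₀ : R'.sectionsRing U)
  [IsLocalization.Away v₀ L]

/-- The localisation chart at an element of the irrelevant ideal `⊕_{n>0} 𝒥ₙ(U) tⁿ` misses the
vertex, so lands in `B₊`. [cite: Wlodarczyk2022, Def. 5.1.1] -/
theorem apply_specMap_mem_plus (hv₀ : v₀ ∈ (R'.filtration U).irrelevant)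
    (x : Spec (CommRingCat.of L)) :
    R'.openCover.f ⟨U.1, U.2⟩
      (Spec.map (CommRingCat.ofHom (algebraMap (R'.sectionsRing U) L)) x) ∈ R'.plus := by
  have hx : Spec.map (CommRingCat.ofHom (algebraMap (R'.sectionsRing U) L)) x ∈ R'.plusChart U := by
    rw [R'.mem_plusChart_iff]
    intro hle
    exact x.2.ne_top (Ideal.eq_top_of_isUnit_mem _ (hle hv₀)
      (IsLocalization.Away.algebraMap_isUnit v₀))
  exact R'.image_plusChart_le_plus ⟨U.1, U.2⟩ ⟨_, hx, rfl⟩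

/-- A point of `B₊` in an open lying over `U` maps to `U`. [folklore] -/
theorem π_apply_mem (y' : (R'.plus : Scheme.{0})) (O : (R'.plus : Scheme.{0}).Opens)
    (hO : O ≤ R'.πPlus ⁻¹ᵁ (U : Y.Opens)) (hy' : y' ∈ O) : R'.π y'.1 ∈ (U : Y.Opens) := by
  have h : y' ∈ R'.πPlus ⁻¹ᵁ (U : Y.Opens) := hO hy'
  rwa [ReesFiltration.πPlus, Scheme.Hom.comp_preimage] at h

variable (ψ : Spec (CommRingCat.of L) ⟶ (R'.plus : Scheme.{0})) [IsOpenImmersion ψ]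
  (hψ : ψ ≫ R'.plus.ι =
    Spec.map (CommRingCat.ofHom (algebraMap (R'.sectionsRing U) L)) ≫ R'.openCover.f ⟨U.1, U.2⟩)

include hψ in
/-- A point of `B₊` whose point `q` of `Spec ⊕ 𝒥ₙ(U) tⁿ` lies in `D(v₀)` is in the chart
`ψ(Spec L)`, `L = (⊕ 𝒥ₙ(U) tⁿ)[1/v₀]`. [folklore] -/
theorem mem_image_of_not_mem (q : Spec (CommRingCat.of (R'.sectionsRing U)))
    (hq : v₀ ∉ q.asIdeal) (y' : (R'.plus : Scheme.{0}))
    (hqy : R'.openCover.f ⟨U.1, U.2⟩ q = y'.1) : y' ∈ ψ ''ᵁ ⊤ := by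
  have hq' : q ∈ Set.range (PrimeSpectrum.comap (algebraMap (R'.sectionsRing U) L)) := by
    rw [PrimeSpectrum.localization_away_comap_range L v₀]
    exact hq
  obtain ⟨x, hx⟩ := hq'
  have h2 : ψ x = y' := by
    apply R'.plus.ι.isOpenEmbedding.injective
    rw [← Scheme.Hom.comp_apply, Scheme.Opens.ι_apply, ← hqy, ← hx, hψ, Scheme.Hom.comp_apply]
    rfl
  exact ⟨x, trivial, h2⟩

/-- **`D(β t^D)` contains every point near which `σ₊♯β = (t⁻¹)^D · unit`.** If on an open
`O ∋ y'` of `B₊` over `U` a unit `η₀` satisfies `η₀ (t⁻¹)^D = σ₊♯β`, then `v₀ ∉ q` for the point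
`q` of `Spec ⊕ 𝒥ₙ(U) tⁿ` under `y'` — provided "`u (t⁻¹)^D = β ⟹ v₀` is a unit" in every
localisation `(⊕ 𝒥ₙ(U) tⁿ)[1/g]` (`hcancel`; true for `v₀ = β t^D` as `t⁻¹` is a non-zero-divisor):
restrict to a chart `D(g) ∋ q` inside `O`. [cite: Wlodarczyk2022, §2.3.3] -/
theorem not_mem_of_isUnit {Dg : ℕ} (β : Γ(Y, U))
    (hcancel : ∀ (Lg : Type) [CommRing Lg] [Algebra (R'.sectionsRing U) Lg]
      (g : R'.sectionsRing U) [IsLocalization.Away g Lg] (u : Lg), IsUnit u →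
      u * algebraMap (R'.sectionsRing U) Lg
          ⟨T (-1), (R'.filtration U).T_neg_one_mem_extendedRees⟩ ^ Dg =
        algebraMap (R'.sectionsRing U) Lg (algebraMap Γ(Y, U) (R'.sectionsRing U) β) →
      IsUnit (algebraMap (R'.sectionsRing U) Lg v₀))
    (y' : (R'.plus : Scheme.{0})) (O : (R'.plus : Scheme.{0}).Opens)
    (hO : O ≤ R'.πPlus ⁻¹ᵁ (U : Y.Opens)) (hy' : y' ∈ O) (η₀ : Γ((R'.plus : Scheme.{0}), O))
    (hη₀ : IsUnit η₀) (heq : η₀ * tInvOn R' O ^ Dg = R'.πPlus.appLE U O hO β)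
    (q : Spec (CommRingCat.of (R'.sectionsRing U))) (hqy : R'.openCover.f ⟨U.1, U.2⟩ q = y'.1) :
    v₀ ∉ q.asIdeal := by
  -- a basic open `D(g) ∋ q` of the chart of `B` over `U` mapping into `O`
  have hqO : q ∈ R'.openCover.f ⟨U.1, U.2⟩ ⁻¹ᵁ (R'.plus.ι ''ᵁ O) := by
    change R'.openCover.f ⟨U.1, U.2⟩ q ∈ R'.plus.ι ''ᵁ O
    rw [hqy]
    exact ⟨y', hy', rfl⟩
  obtain ⟨f, hfO, hqf⟩ := (isAffineOpen_top (Spec (CommRingCat.of (R'.sectionsRing U)))).exists_basicOpen_le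
    ⟨q, hqO⟩ (Opens.mem_top q)
  rw [basicOpen_eq_of_affine'] at hfO hqf
  set g : R'.sectionsRing U := (Scheme.ΓSpecIso (CommRingCat.of (R'.sectionsRing U))).hom f with hg
  change PrimeSpectrum.basicOpen g ≤ _ at hfO
  change q ∈ PrimeSpectrum.basicOpen g at hqf
  -- the chart `ψg : Spec (⊕ 𝒥ₙ(U) tⁿ)[1/g] ⟶ B₊`, with image inside `O`
  have hrange : ∀ x : Spec (CommRingCat.of (Localization.Away g)),
      Spec.map (CommRingCat.ofHom (algebraMap (R'.sectionsRing U) (Localization.Away g))) x ∈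
        (PrimeSpectrum.basicOpen g : Set (PrimeSpectrum (R'.sectionsRing U))) := fun x => by
    rw [← PrimeSpectrum.localization_away_comap_range (Localization.Away g) g]
    exact ⟨x, rfl⟩
  obtain ⟨ψg, hψg⟩ := exists_fac R' U (Localization.Away g)
    fun x => Scheme.Opens.ι_image_le _ _ (hfO (hrange x))
  haveI := isOpenImmersion_of_fac R' U (Localization.Away g) ψg hψg g
  have hle : ψg ''ᵁ ⊤ ≤ O := by
    rintro _ ⟨x, -, rfl⟩
    have hx : (ψg ≫ R'.plus.ι) x ∈ R'.plus.ι ''ᵁ O := by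
      rw [hψg]
      exact hfO (hrange x)
    rw [Scheme.Hom.comp_apply, Scheme.Hom.apply_mem_image_iff] at hx
    exact hx
  -- restrict the identity `η₀ (t⁻¹)^D = σ₊♯β` to the chart and read it in `(⊕ 𝒥ₙ(U) tⁿ)[1/g]`
  obtain ⟨res, hres⟩ : ∃ res : Γ((R'.plus : Scheme.{0}), O) →+* Γ((R'.plus : Scheme.{0}), ψg ''ᵁ ⊤),
      res = ((R'.plus : Scheme.{0}).presheaf.map (homOfLE hle).op).hom := ⟨_, rfl⟩
  have hres₁ : res (tInvOn R' O) = tInvOn R' (ψg ''ᵁ ⊤) := by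
    rw [hres]
    exact stub_qs_tInvOn_map R' hle
  have hres₂ : res (R'.πPlus.appLE U O hO β) =
      R'.πPlus.appLE U (ψg ''ᵁ ⊤) (image_top_le R' U _ ψg hψg) β := by
    rw [hres]
    exact map_appLE U R'.πPlus O _ hle hO β
  have h1 : res (η₀ * tInvOn R' O ^ Dg) = res η₀ * tInvOn R' (ψg ''ᵁ ⊤) ^ Dg :=
    (map_mul res _ _).trans (congrArg (res η₀ * ·)
      ((map_pow res _ _).trans (congrArg (· ^ Dg) hres₁)))
  have heq' : res η₀ * tInvOn R' (ψg ''ᵁ ⊤) ^ Dg =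
      R'.πPlus.appLE U (ψg ''ᵁ ⊤) (image_top_le R' U _ ψg hψg) β :=
    h1.symm.trans ((congrArg res heq).trans hres₂)
  let eg := (ψg.appIso ⊤ ≪≫ Scheme.ΓSpecIso (CommRingCat.of (Localization.Away g))).commRingCatIsoToRingEquiv
  have k1 : eg (res η₀ * tInvOn R' (ψg ''ᵁ ⊤) ^ Dg) =
      eg (res η₀) * algebraMap (R'.sectionsRing U) (Localization.Away g)
        ⟨T (-1), (R'.filtration U).T_neg_one_mem_extendedRees⟩ ^ Dg :=
    (map_mul (eg) _ _).trans (congrArg (eg (res η₀) * ·)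
      ((map_pow (eg) _ _).trans (congrArg (· ^ Dg) (chartIso_tInvOn R' U _ ψg hψg))))
  have key : eg (res η₀) * algebraMap (R'.sectionsRing U) (Localization.Away g)
      ⟨T (-1), (R'.filtration U).T_neg_one_mem_extendedRees⟩ ^ Dg =
      algebraMap (R'.sectionsRing U) (Localization.Away g)
        (algebraMap Γ(Y, U) (R'.sectionsRing U) β) :=
    k1.symm.trans ((congrArg (eg) heq').trans (chartIso_appLE R' U _ ψg hψg β))
  have hu := hcancel (Localization.Away g) g _ ((hη₀.map res).map _) key
  -- `q ∈ D(g)` is the image of a point of `Spec (⊕ 𝒥ₙ(U) tⁿ)[1/g]`, where `v₀` is a unit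
  obtain ⟨x, hx⟩ : q ∈ Set.range
      (PrimeSpectrum.comap (algebraMap (R'.sectionsRing U) (Localization.Away g))) := by
    rw [PrimeSpectrum.localization_away_comap_range (Localization.Away g) g]
    exact hqf
  intro hv
  rw [← hx] at hv
  exact x.2.ne_top (Ideal.eq_top_of_isUnit_mem _ hv hu)

/-- **The chart `D(v₀)` of `B₊`, packaged**: for `v₀` in the irrelevant ideal, an affine open
`W'` of `B₊` over `U` with `Γ(B₊, W') ≅ L = (⊕ 𝒥ₙ(U) tⁿ)[1/v₀]` matching `σ₊♯`, `t⁻¹` and the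
strict transforms, and containing every point of `B₊` whose point of `Spec ⊕ 𝒥ₙ(U) tⁿ` lies in
`D(v₀)`. [cite: Wlodarczyk2022, §2.3.3] -/
theorem exists_chart [IsLocallyNoetherian R'.cobordantBlowup]
    (hv₀ : v₀ ∈ (R'.filtration U).irrelevant) :
    ∃ (W' : (R'.plus : Scheme.{0}).affineOpens)
      (hW' : (W' : (R'.plus : Scheme.{0}).Opens) ≤ R'.πPlus ⁻¹ᵁ (U : Y.Opens))
      (e : Γ((R'.plus : Scheme.{0}), W') ≃+* L),
      (∀ s : Γ(Y, U), e (R'.πPlus.appLE U W' hW' s) =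
        algebraMap (R'.sectionsRing U) L (algebraMap Γ(Y, U) (R'.sectionsRing U) s)) ∧
      e (tInvOn R' W') = algebraMap (R'.sectionsRing U) L
        ⟨T (-1), (R'.filtration U).T_neg_one_mem_extendedRees⟩ ∧
      (∀ K : Y.IdealSheafData, (R'.strictTransformPlus K).ideal W' =
        (⨆ n : ℕ, ((K.ideal U).map ((algebraMap (R'.sectionsRing U) L).comp
          (algebraMap Γ(Y, U) (R'.sectionsRing U)))).colon
          ((Ideal.span {algebraMap (R'.sectionsRing U) L
            ⟨T (-1), (R'.filtration U).T_neg_one_mem_extendedRees⟩} ^ n : Ideal L) :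
              Set L)).comap e.toRingHom) ∧
      ∀ (y' : (R'.plus : Scheme.{0})) (q : Spec (CommRingCat.of (R'.sectionsRing U))),
        R'.openCover.f ⟨U.1, U.2⟩ q = y'.1 → v₀ ∉ q.asIdeal →
          y' ∈ (W' : (R'.plus : Scheme.{0}).Opens) := by
  obtain ⟨ψ, hψ⟩ := exists_fac R' U L (apply_specMap_mem_plus R' U L v₀ hv₀)
  haveI := isOpenImmersion_of_fac R' U L ψ hψ v₀
  exact ⟨⟨ψ ''ᵁ ⊤, (isAffineOpen_top _).image_of_isOpenImmersion ψ⟩, image_top_le R' U L ψ hψ, _,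
    chartIso_appLE R' U L ψ hψ, chartIso_tInvOn R' U L ψ hψ,
    strictTransformPlus_ideal_chart R' U L ψ hψ,
    fun y' q hqy hq => mem_image_of_not_mem R' U L v₀ ψ hψ q hq y' hqy⟩

end MemIff

/-! ## Registered form -/

/-- **Registered sub-goal `stub_qs_atlasAmbientChart`** of the crux (helper of the stub
`stub_qs_atlas_ambient`): the sections of the strict transform over an affine open of `B₊` over
`U` are the `t⁻¹`-saturation of the extension of `K(U)`. [cite: Wlodarczyk2022, 3.3.12] -/
theorem stub_qs_atlasAmbientChart :
    ∀ {Y : Scheme.{0}} (R' : Literature.AlgebraicGeometry.Resolution.ReesFiltration Y)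
      [IsLocallyNoetherian R'.cobordantBlowup] (K : Y.IdealSheafData) (U : Y.affineOpens)
      (W' : (R'.plus : Scheme.{0}).affineOpens)
      (hW' : (W' : (R'.plus : Scheme.{0}).Opens) ≤ R'.πPlus ⁻¹ᵁ (U : Y.Opens)),
      (R'.strictTransformPlus K).ideal W' =
        ⨆ n : ℕ, ((K.ideal U).map (R'.πPlus.appLE U W' hW').hom).colon
          ((Ideal.span {Summit.ResolutionOfSingularities.ResolutionOfSingularities.Theorems.tInvOn R' W'} ^ n :
            Ideal Γ((R'.plus : Scheme.{0}), W')) : Set Γ((R'.plus : Scheme.{0}), W')) :=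
  fun R' _ K U W' hW' => strictTransformPlus_ideal_eq R' K U W' hW'

end Summit.ResolutionOfSingularities.ResolutionOfSingularities.Theorems.DatumToEmbedded.AtlasAmbient
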